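import Literature.Computability.Cryptography.SequenceProblems
import Literature.Computability.Cryptography.EditDistFacts
import HarnessLib

/-!
# Sequence similarity problems: discharges of the named facts of `SequenceProblems`

This file proves, from the Wagner–Fischer recursion alone, the named facts

* `editDist_eq_zero_iff` of `Literature.Computability.Cryptography.SequenceProblems`
  (`editDist_eq_zero_iff_holds`): the Levenshtein distance `editDist l₁ l₂` vanishes exactly when
  `l₁ = l₂`;
* `editDist_triangle` of `Literature.Computability.Cryptography.SequenceProblems`
  (`editDist_triangle_holds`): the triangle inequality
  `editDist l₁ l₃ ≤ editDist l₁ l₂ + editDist l₂ l₃`, using the one-symbol perturbation bounds and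
  the length bounds of `EditDistFacts`.

(The symmetry fact `editDist_comm` is discharged in `EditDistFacts`.)

## References

* R. A. Wagner, M. J. Fischer, *The string-to-string correction problem*, J. ACM 21 (1974)
  168–173, doi:10.1145/321796.321811: §2, p. 169 (with a cost function that is symmetric and
  strictly positive on every operation `a → b`, `a ≠ b`, the edit distance `δ` is a metric on
  strings); §3, Lemma 1 and Theorem 1, pp. 170–171 (traces compose:
  `cost (T₁ ∘ T₂) ≤ cost T₁ + cost T₂`; the cheapest trace costs `δ`); §4, Theorems 2–3, p. 171
  (the recursion and its border values).

## Design

The proof is by the functional induction principle `editDist.induct` on the three defining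
equations `editDist_nil_left`, `editDist_nil_right`, `editDist_cons_cons`; no traces are needed.
For the triangle inequality the printed argument (edit sequences from `l₁` to `l₂` and from `l₂`
to `l₃` concatenate) is run along the recursion: by functional induction on `(l₁, l₂)`,
generalised over `l₃`, each of the three branches of `editDist_cons_cons` (the three kinds of
last edit operation, Wagner–Fischer Thm. 2) is absorbed into `editDist l₁ l₃` by a one-edit
perturbation bound of `EditDistFacts` (`editDist_cons_left_le`: a deletion costs at most `1`;
`editDist_le_cons_left`: undoing an insertion costs at most `1`) or, for the change/match branch,
by the auxiliary `editDist_cons_le_of_forall_le`, proved by induction on `l₃`.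
-/

namespace Literature.Computability.Cryptography

variable {α : Type*} [DecidableEq α]

/-- **Discharge of `editDist_eq_zero_iff`**: the edit distance vanishes exactly on equal lists.
With unit costs the cost function is symmetric and strictly positive on every operation `a → b`
with `a ≠ b`, so `δ` is a metric on strings (Wagner–Fischer 1974, §2, p. 169, the remark after the
definition of `δ`); in particular `δ(A, B) = 0 ↔ A = B`. The Lean proof runs along the recursion
(Wagner–Fischer 1974, Theorems 2–3, p. 171, mirrored to the heads): the deletion and insertion
branches cost at least `1`, so `editDist (x :: xs) (y :: ys) = 0` forces the change branch to
vanish, i.e. `x = y` and `editDist xs ys = 0`, and induction concludes.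
[cite: WagnerFischer1974, §2, p. 169] -/
theorem editDist_eq_zero_iff_holds : editDist_eq_zero_iff (α := α) := by
  intro l₁ l₂
  induction l₁, l₂ using editDist.induct with
  | case1 l => rw [editDist_nil_left, List.length_eq_zero_iff]; exact eq_comm
  | case2 x xs => simp
  | case3 x xs y ys _ _ ih =>
      rw [editDist_cons_cons, List.cons_eq_cons, ← ih]
      constructor
      · intro h
        split_ifs at h with hxy
        · exact ⟨hxy, by omega⟩
        · exfalso; omega
      · rintro ⟨hxy, h⟩
        rw [if_pos hxy]
        omega

/-- Usable form of `editDist_eq_zero_iff_holds`: `editDist l₁ l₂ = 0 ↔ l₁ = l₂`.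
[cite: WagnerFischer1974, §2, p. 169] -/
theorem editDist_eq_zero_iff' (l₁ l₂ : List α) : editDist l₁ l₂ = 0 ↔ l₁ = l₂ :=
  editDist_eq_zero_iff_holds l₁ l₂

/-- Distinct lists are at positive edit distance (the metric is definite; Wagner–Fischer 1974,
§2, p. 169). [cite: WagnerFischer1974, §2, p. 169] -/
theorem editDist_pos_iff (l₁ l₂ : List α) : 0 < editDist l₁ l₂ ↔ l₁ ≠ l₂ := by
  rw [Nat.pos_iff_ne_zero, Ne, editDist_eq_zero_iff' l₁ l₂]

/-! ### The triangle inequality (discharge of `editDist_triangle`) -/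

/-- **Change/match step of the triangle inequality.** If the triangle inequality holds from `xs`
through `ys` (for every third list), then for all heads `x, y` and every `l`,
`editDist (x :: xs) l ≤ editDist xs ys + [x ≠ y] + editDist (y :: ys) l`: first change `x` into
`y` (cost `[x ≠ y]`), then follow a cheapest edit sequence of `(y :: ys, l)`, whose treatment of
the head `y` (delete it, insert the head of `l` in front of it, or pair it with the head of `l`;
Wagner–Fischer 1974, Thm. 2) dictates what to do with the changed head. Proof by induction on `l`,
using the length bound `length_le_editDist_add_length_right` for `l = []`.
[cite: WagnerFischer1974, §2 (p. 169) and Thm. 2] -/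
theorem editDist_cons_le_of_forall_le (x y : α) (xs ys : List α)
    (h : ∀ l : List α, editDist xs l ≤ editDist xs ys + editDist ys l) (l : List α) :
    editDist (x :: xs) l ≤ editDist xs ys + (if x = y then 0 else 1) + editDist (y :: ys) l := by
  induction l with
  | nil =>
      have := length_le_editDist_add_length_right xs ys
      simp only [editDist_nil_right, List.length_cons]
      split_ifs <;> omega
  | cons z zs ih =>
      have h1 := h (z :: zs)
      have h2 := h zs
      rw [editDist_cons_cons x z, editDist_cons_cons y z]
      by_cases hxy : x = y
      · subst hxy
        rw [if_pos rfl] at ih ⊢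
        split_ifs <;> omega
      · rw [if_neg hxy] at ih ⊢
        split_ifs <;> omega

/-- **Discharge of `editDist_triangle`**: the edit distance satisfies the triangle inequality
`editDist l₁ l₃ ≤ editDist l₁ l₂ + editDist l₂ l₃` (Wagner–Fischer 1974, §2, p. 169: with unit
costs `δ` is a metric, because edit sequences — equivalently traces, §3, Lemma 1, p. 170:
`cost (T₁ ∘ T₂) ≤ cost T₁ + cost T₂` — compose, and Theorems 1–3 identify `δ` with the recursion
defining `editDist`). Lean proof: functional induction on `(l₁, l₂)` along `editDist.induct`,
generalised over `l₃`; the border cases are the length bound `length_le_editDist_add_length_left`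
and `editDist_le_max_length`, and the three branches of `editDist_cons_cons` are closed by
`editDist_cons_left_le`, `editDist_le_cons_left` and `editDist_cons_le_of_forall_le`.
[cite: WagnerFischer1974, §2 (p. 169) and §3 Lemma 1] -/
theorem editDist_triangle_holds : (editDist_triangle (α := α)) := by
  intro l₁ l₂
  induction l₁, l₂ using editDist.induct with
  | case1 l =>
      intro l₃
      have := length_le_editDist_add_length_left l l₃
      simp only [editDist_nil_left]
      omega
  | case2 a xs =>
      intro l₃
      have := editDist_le_max_length (a :: xs) l₃
      simp only [editDist_nil_right, editDist_nil_left, List.length_cons] at *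
      omega
  | case3 a xs b ys ih1 ih2 ih3 =>
      intro l₃
      have hA := editDist_cons_left_le a xs l₃
      have hB := editDist_le_cons_left b ys l₃
      have h1 := ih1 l₃
      have h2 := ih2 l₃
      have hC := editDist_cons_le_of_forall_le a b xs ys ih3 l₃
      rw [editDist_cons_cons]
      split_ifs at * <;> omega

/-- The triangle inequality of `editDist`, usable form of `editDist_triangle_holds`.
[cite: WagnerFischer1974, §2 (p. 169)] -/
theorem editDist_triangle' (l₁ l₂ l₃ : List α) :
    editDist l₁ l₃ ≤ editDist l₁ l₂ + editDist l₂ l₃ :=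
  editDist_triangle_holds l₁ l₂ l₃

end Literature.Computability.Cryptography
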